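/-
Copyright (c) 2026 the pub-hodgecm-mathlib formalisation cell (harness21).  Prover seat hodgecm-mathlib-K2E3-p26 (g3), Track B «K2-LIT», hLiu418 = `stmt-HodgeConjecture-24832`;
socket #41, KIND W, (iii-fin) row — KW desk F0P2-p08 (g4) 01:31:06Z (D): (KW-fin-sup) FILE 2, the `v ∈ S₀` FACE of the per-place SUP letter (B) of ★ p863720 (K2E3-p03 (g10)'s
Finding 3; his FILE 1 ★ `K2LiuKindWFiniteSectionSupBound` carries Findings 1–2 and the hypothesis-first head `hsup_of_height_of_bad (hbad)`, whose FROZEN `hbad` letter this file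
pays and whose head it closes for a STANDARD datum).  THEOREMS ONLY (no `def`, no `instance`, no notation, no named-fact hypothesis, no `sorry`); lane `--supports …-24832`.
-/
import Summits.HodgeConjecture.HodgeConjecture.Theorems.K2LiuKindWFiniteSectionSupBound         -- ★ p864372 K2E3-p03 (g10) FILE 1: Finding 1 `norm_det_blkA_matW_le`, `norm_apply_evalPlace_le_localHeight`, the head `hsup_of_height_of_bad`
import Summits.HodgeConjecture.HodgeConjecture.Theorems.K2LiuKindWFactorizationReadings        -- ★ p863597 (this seat): the (KW-fac) letters `hb` (flat twists in `I_v(s,χ_v)` at EVERY `s`), the reading `hread`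
import Summits.HodgeConjecture.HodgeConjecture.Theorems.K2LiuIsStdPlaceAdapted                  -- ★ `exists_isStd_placeAdapted` (local Iwasawa `H(L⁺_v) = P_Δ(L⁺_v)·K₀`, `K₀` compact)
import Summits.HodgeConjecture.HodgeConjecture.Theorems.K2LiuStdFamilyAwayPurityFlat            -- ★ `continuous_heightLoc` (`H_v = Φ_𝒦 ∘ ι_v` is continuous)
import Summits.HodgeConjecture.HodgeConjecture.Theorems.K2LiuLocalIntertwiningProperty          -- ★ `absDetDelta_pos`
import Summits.HodgeConjecture.HodgeConjecture.Theorems.K2LiuA7NormalisedRegularitySetup        -- ★ `continuous_of_isSmooth`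
import Summits.HodgeConjecture.HodgeConjecture.Theorems.K2LiuKindWCarrierHaarVolume             -- ★ `le_absNorm_pow_natCeil` (constants ↦ `N(𝔭_w)^⌈·⌉`)
import Summits.HodgeConjecture.HodgeConjecture.Theorems.K2LiuKindOneLineDecayLowerPowerFace        -- ★ `rpow_le_rpow_abs` (`z^t ≤ a^{|t|}`; reused per dedup)
import Literature.NumberTheory.GelbartRogawski1991.LocalDoubledUnitaryBetaUnitary              -- ★ `norm_chiDet_eq_one` (unitary local characters)
import Literature.NumberTheory.GelbartRogawski1991.LocalDoubledUnitarySplitParabolic            -- ★ `detDelta_eq_det_blkA`, `matW`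
import Literature.NumberTheory.K2Lit.LocalDoublingSiegel                                      -- ★ `mem_siegelDeltaLoc_iff_local`
import Literature.NumberTheory.Automorphic.AdelicHeightGLProofs                                -- ★ `GLn.one_le_localHeight`
import HarnessLib

/-!
# Crux `HLiu418`, socket #41, KIND W — `K2LiuKindWFiniteSectionSupBoundBad`: THE SUP OF THE (KW-fac) LOCAL FACTOR `H_v^{2(s−s₀)}·b_{j,v}` ON `(w_Δ)_v·N_Δ(L⁺_v)·h_v`
# AT A BAD PLACE `v ∈ S₀`, IN HEIGHT CURRENCY — the `hbad` letter of ★ `K2LiuKindWFiniteSectionSupBound.hsup_of_height_of_bad`, and that head CLOSED for `𝒦` standard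

Cell `hodgecm-mathlib`, crux item hLiu418 = `stmt-HodgeConjecture-24832` (helper lane `--supports … --as helper`, count-neutral), route of record `HCCMUnconditional`;
squad K2 ∕ K2Liu, road `K2_Liu`, socket #41 `sig_K2LiuSiegelEisensteinContinuation`, KIND W, (iii-fin) row; author K2E3-p26 (g3); KW desk F0P2-p08 (g4); FILE 1 K2E3-p03 (g10).
THE MATHEMATICS [KudlaRallis1994, §2], [HarrisKudlaSweet1996, §1 (1.11), (1.15)], [Kudla1994, §3], [BorelJacquet1979, §1.2, §4.1], [Casselman1980, §3].  At `v ∈ S₀` the local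
factor of the (KW-fac) reading is `φ_s := H_v^{2(s−s₀)}·b_{j,v}`, a SMOOTH SIEGEL SECTION OF WEIGHT `(χ_v, s)` for EVERY `s` (★ p863597's letter `hb`), so `H_v` is never computed on
the big cell: with the LOCAL Iwasawa decomposition `H(L⁺_v) = P_Δ(L⁺_v)·K₀`, `K₀` COMPACT (★ `exists_isStd_placeAdapted`, `𝒦` standard), `(w_Δ)_v·y·h_v = p·k` and the section law AT `s`:
`φ_s(p k) = χ_v(det_Δ p)|det_Δ p|_v^{s+n∕2}·φ_s(k)`; `|χ_v| = 1` (★ `norm_chiDet_eq_one`); `|φ_s(k)| ≤ M_v^{2|re s − re s₀|}·B_v` (`H_v^{±1} ≤ M_v`, `|b_{j,v}| ≤ B_v` on `K₀`: continuity on a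
compact); `|det_Δ p|_v = ∏_{w∣v} ‖det A(p_w)‖_w` (★ `detDelta_eq_det_blkA`) `≤ ∏_{w∣v} (‖2‖_w⁻¹·H_w(h)·R_v)^n` UNIFORMLY IN `y` by K2E3-p03 (g10)'s Finding 1 (★ `norm_det_blkA_matW_le`:
`A(p_w) = C((h_v k⁻¹)_w)`; entries of `h_v` by ★ `norm_apply_evalPlace_le_localHeight`, of `k⁻¹` bounded on `K₀`).  With `r := re z∕2`: `re s + n∕2 ≤ ⌈3 re z∕2 + n∕2⌉`,
`2|re s − re s₀| ≤ ⌈3 re z + 2|re s₀|⌉`; all constants go into `N(𝔭_w)^{β w}` on the places over `S₀` (★ `le_absNorm_pow_natCeil`).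
§1 generic bookkeeping (`a·∏ f ≤ ∏ (a·f)`, inverse entries bounded on a compact of `H(F_v)`); §2 the constants of a standard datum on a compact of `H(L⁺_v)`; §3 **`exists_const_of_bad`** (ONE bad place, uniform in `y`); §4 HEAD **`hbad_of_std`**
⊢ `∃ Tb, ‹hbad›` (K2E3-p03 (g10)'s FROZEN bytes 01:36:31Z; `Tb :=` the places over `S₀`); §5 **`hsup_of_height`** = ★ `hsup_of_height_of_bad` ∘ §4: `∃ b₁ Tβ, ‹★ p863720 :243–:254›`.

HONEST LABEL.  Count-neutral helper; it retires nothing by itself: `HC_CM` is proved only modulo the 7 printed citations (2 remaining named inputs: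
hLiu418 = `stmt-HodgeConjecture-24832`, h413 = `stmt-HodgeConjecture-24833`) until rung 0 closes.

## References
* [KudlaRallis1994] S. Kudla, S. Rallis, *A regularized Siegel–Weil formula: the first term identity*, Ann. of Math. 140 (1994), §2 (sections on `P·wN`, uniform bounds).
* [HarrisKudlaSweet1996] M. Harris, S. Kudla, W. J. Sweet, *Theta dichotomy for unitary groups*, J. AMS 9 (1996), §1 (1.11), (1.15) (`P_Δ`, `I_v(s,χ_v)`, `|det_Δ|`).
* [Kudla1994] S. Kudla, *Splitting metaplectic covers of dual reductive pairs*, Israel J. Math. 87 (1994), §3 (adapted blocks of `U(𝕍 ⊕ −𝕍)`).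
* [BorelJacquet1979] A. Borel, H. Jacquet, Proc. Sympos. Pure Math. 33.1 (1979), §1.2 (heights), §4.1 (`K = ∏ K_v`, Iwasawa decomposition).
* [Casselman1980] W. Casselman, Compositio Math. 40 (1980), §3 (smooth vectors are locally constant).
* [NeukirchANT1999] J. Neukirch, *Algebraic Number Theory*, Springer (1999), Ch. II §4 (normalised absolute values).
-/

set_option autoImplicit false
-- the mandated namespace repeats the single-problem summit's segment (`HodgeConjecture.HodgeConjecture`)
set_option linter.dupNamespace false

noncomputable section

open scoped Matrix RestrictedProduct ENNReal NNReal Topology ComplexConjugate BigOperators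
open scoped Classical
open NumberField IsDedekindDomain MeasureTheory Measure Filter Set
open Literature.NumberTheory.Automorphic hiding IsKFinite
open Literature.NumberTheory.Automorphic.UnitaryGroup Literature.NumberTheory.GaloisRepresentations Literature.NumberTheory.LFunctions
open Literature.NumberTheory.GelbartRogawski1991 Literature.NumberTheory.GelbartRogawski1991.GRConstruction
open Literature.NumberTheory.GelbartRogawski1991.AdaptedBlocks
open Literature.NumberTheory.GelbartRogawski1991.UnitaryDualPair Literature.NumberTheory.GelbartRogawski1991.UnitaryDualPair.LocalSplitting
open Literature.NumberTheory.K2Lit.SiegelDoubled Literature.NumberTheory.K2Lit.LocalSiegelDoubled Literature.NumberTheory.K2Lit.PlaceSplitting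
open Summit.HodgeConjecture.HodgeConjecture.Cruxes.HLiu418.K2LiuSiegelUnipotentLocalDefs
open Summit.HodgeConjecture.HodgeConjecture.Cruxes.HLiu418.K2LiuSiegelUnipotentFourierDefs
open Summit.HodgeConjecture.HodgeConjecture.Cruxes.HLiu418.K2LiuSiegelEisensteinKindWLetters (kindWFinset)
open Summit.HodgeConjecture.HodgeConjecture.Cruxes.HLiu418.K2LiuKindWFiniteLetterDefs (kindWLocalBall)
open Summit.HodgeConjecture.HodgeConjecture.Cruxes.HLiu418.K2LiuIsStdPlaceAdapted (exists_isStd_placeAdapted)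
open Summit.HodgeConjecture.HodgeConjecture.Cruxes.HLiu418.K2LiuLocalIntertwiningProperty (absDetDelta_pos)
open Summit.HodgeConjecture.HodgeConjecture.Cruxes.HLiu418.K2LiuA7NormalisedRegularitySetup (continuous_of_isSmooth)
open Summit.HodgeConjecture.HodgeConjecture.Cruxes.HLiu418.K2LiuIwasawaHeightContinuous (iwasawaHeight_pos)
open Summit.HodgeConjecture.HodgeConjecture.Cruxes.HLiu418.K2LiuStdFamilyAwayPurityFlat (continuous_heightLoc)
open Summit.HodgeConjecture.HodgeConjecture.Cruxes.HLiu418.K2LiuKindWCarrierHaarVolume (le_absNorm_pow_natCeil)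
open Summit.HodgeConjecture.HodgeConjecture.Cruxes.HLiu418.K2LiuKindOneLineDecayLowerPowerFace (rpow_le_rpow_abs)
open Summit.HodgeConjecture.HodgeConjecture.Cruxes.HLiu418.K2LiuKindWFiniteSectionSupBound (norm_det_blkA_matW_le norm_apply_evalPlace_le_localHeight hsup_of_height_of_bad)

namespace Summit.HodgeConjecture.HodgeConjecture.Cruxes.HLiu418.K2LiuKindWFiniteSectionSupBoundBad

/-! ## §1 Generic bookkeeping -/

section Generic
/-- `a · ∏ f ≤ ∏ (a · f)` over a nonempty finite type when `1 ≤ a` and `0 ≤ f`. [folklore] -/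
theorem mul_prod_le_prod_mul {ι : Type*} [Fintype ι] [Nonempty ι] {a : ℝ} (ha : 1 ≤ a) {f : ι → ℝ} (hf : ∀ i, 0 ≤ f i) :
    a * ∏ i, f i ≤ ∏ i, a * f i := by
  rw [Finset.prod_mul_distrib, Finset.prod_const, Finset.card_univ]
  exact mul_le_mul_of_nonneg_right (le_self_pow₀ ha Fintype.card_ne_zero) (Finset.prod_nonneg fun i _ => hf i)

variable (F : Type) [Field F] [NumberField F] (E : Type) [Field E] [NumberField E] [Algebra F E] (c : E ≃ₐ[F] E) (N : ℕ) (J : Matrix (Fin N) (Fin N) E)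
  (v : HeightOneSpectrum (𝓞 F))

/-- **the entries of `κ⁻¹` are bounded on a compact set of `H(F_v)`** (inversion, the coordinate projection `w`, `Units.val` and the matrix entries are continuous).
[cite: BorelJacquet1979, §1.2] -/
theorem exists_bound_entries_inv_of_isCompact {C : Set (localPi E c N J v)} (hC : IsCompact C) :
    ∃ R : ℝ, 1 ≤ R ∧ ∀ κ ∈ C, ∀ (w : PlacesOver E v) (a b : Fin N),
      ‖(((κ⁻¹ : localPi E c N J v) : LocalGLPi E N v) w : GL (Fin N) (w.1.adicCompletion E)).val a b‖ ≤ R := by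
  have hcont : ∀ (w : PlacesOver E v) (a b : Fin N), Continuous fun κ : localPi E c N J v =>
      ‖(((κ⁻¹ : localPi E c N J v) : LocalGLPi E N v) w : GL (Fin N) (w.1.adicCompletion E)).val a b‖ := fun w a b =>
    continuous_norm.comp ((Units.continuous_val.comp ((continuous_apply w).comp (continuous_subtype_val.comp continuous_inv))).matrix_elem a b)
  have hbd : ∀ (w : PlacesOver E v) (a b : Fin N), ∃ R : ℝ, ∀ κ ∈ C,
      ‖(((κ⁻¹ : localPi E c N J v) : LocalGLPi E N v) w : GL (Fin N) (w.1.adicCompletion E)).val a b‖ ≤ R := fun w a b => by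
    obtain ⟨R, hR⟩ := hC.exists_bound_of_continuousOn (hcont w a b).continuousOn
    exact ⟨R, fun κ hκ => le_trans (le_of_eq (by rw [Real.norm_eq_abs, abs_norm])) (hR κ hκ)⟩
  choose R hR using hbd
  refine ⟨max 1 (∑ t : PlacesOver E v × Fin N × Fin N, |R t.1 t.2.1 t.2.2|), le_max_left _ _,
    fun κ hκ w a b => le_trans (hR w a b κ hκ) (le_trans ?_ (le_max_right _ _))⟩
  exact (le_abs_self _).trans (Finset.single_le_sum (f := fun t : PlacesOver E v × Fin N × Fin N => |R t.1 t.2.1 t.2.2|) (fun t _ => abs_nonneg _) (Finset.mem_univ (w, a, b)))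
end Generic

/-! ## §2 Constants of a standard datum on a compact set of `H(L⁺_v)` -/

section CM
variable (L : Type) [Field L] [NumberField L] [IsCMField L]
variable {N M n : ℕ} (e : Fin N × Fin M ≃ Fin n)
  (dV : Fin N → L) (hdV : ∀ i, IsCMField.complexConj L (dV i) = dV i) (hdV0 : ∀ i, dV i ≠ 0)
  (dW : Fin M → L) (hdW : ∀ i, IsCMField.complexConj L (dW i) = dW i) (hdW0 : ∀ i, dW i ≠ 0)

omit [IsCMField L] in
/-- `1 ≤ ‖2‖_w⁻¹` at every finite place `w` of `L` (`‖2‖_w ≤ 1`). [cite: NeukirchANT1999, Ch. II §4] -/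
theorem one_le_inv_norm_two (w : HeightOneSpectrum (𝓞 L)) : 1 ≤ ‖(2 : w.adicCompletion L)‖⁻¹ := by
  have h2le : ‖(2 : w.adicCompletion L)‖ ≤ 1 := by
    have h := NumberField.FinitePlace.norm_le_one (K := L) (v := w) (2 : 𝓞 L)
    simpa only [map_ofNat] using h
  have h2ne : ‖(2 : w.adicCompletion L)‖ ≠ 0 := norm_ne_zero_iff.2 two_ne_zero
  exact one_le_inv_iff₀.2 ⟨lt_of_le_of_ne (norm_nonneg _) (Ne.symm h2ne), h2le⟩

include hdV0 hdW0 in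
/-- **THE HEIGHT CONSTANT**: on a compact `C ⊆ H(L⁺_v)`, `H_v ≤ M_v` and `H_v⁻¹ ≤ M_v` for some `M_v ≥ 1` (`H_v = Φ_𝒦 ∘ ι_v` is continuous and positive: ★ `continuous_heightLoc`,
★ `iwasawaHeight_pos`). [cite: BorelJacquet1979, §4.1] -/
theorem exists_height_const (𝒦 : IwasawaDatum L e dV hdV dW hdW) {v : HeightOneSpectrum (𝓞 (Fp L))} {C : Set (UnitaryGroup.localPi L (IsCMField.complexConj L) (n + n) (hermD L e dV hdV dW hdW) v)}
    (hC : IsCompact C) :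
    ∃ Mv : ℝ, 1 ≤ Mv ∧ ∀ k ∈ C,
      modDelta L e dV hdV dW hdW (𝒦.pPart (locToAdelic L e dV hdV dW hdW v k)) ≤ Mv ∧ (modDelta L e dV hdV dW hdW (𝒦.pPart (locToAdelic L e dV hdV dW hdW v k)))⁻¹ ≤ Mv := by
  have hHc := continuous_heightLoc L e dV hdV hdV0 dW hdW hdW0 v 𝒦
  have hHpos : ∀ u : UnitaryGroup.localPi L (IsCMField.complexConj L) (n + n) (hermD L e dV hdV dW hdW) v,
      0 < modDelta L e dV hdV dW hdW (𝒦.pPart (locToAdelic L e dV hdV dW hdW v u)) := fun u => iwasawaHeight_pos L e dV hdV dW hdW 𝒦 _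
  obtain ⟨M₁, hM₁⟩ := hC.exists_bound_of_continuousOn hHc.continuousOn
  obtain ⟨M₂, hM₂⟩ := hC.exists_bound_of_continuousOn (hHc.inv₀ fun u => (hHpos u).ne').continuousOn
  refine ⟨max 1 (max M₁ M₂), le_max_left _ _, fun k hk => ⟨?_, ?_⟩⟩
  · have h := hM₁ k hk
    beta_reduce at h
    rw [Real.norm_eq_abs, abs_of_pos (hHpos k)] at h
    exact h.trans ((le_max_left _ _).trans (le_max_right _ _))
  · have h := hM₂ k hk
    simp only [Pi.inv_apply, Real.norm_eq_abs, abs_of_pos (inv_pos.2 (hHpos k))] at h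
    exact h.trans ((le_max_right _ _).trans (le_max_right _ _))

/-- **THE VALUE CONSTANT**: finitely many continuous functions are bounded in norm by one `B ≥ 1` on a compact `C ⊆ H(L⁺_v)`. [cite: Casselman1980, §3] -/
theorem exists_norm_const {v : HeightOneSpectrum (𝓞 (Fp L))} {m : ℕ} (φ : Fin m → (UnitaryGroup.localPi L (IsCMField.complexConj L) (n + n) (hermD L e dV hdV dW hdW) v → ℂ)) (hφ : ∀ i, Continuous (φ i))
    {C : Set (UnitaryGroup.localPi L (IsCMField.complexConj L) (n + n) (hermD L e dV hdV dW hdW) v)} (hC : IsCompact C) :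
    ∃ B : ℝ, 1 ≤ B ∧ ∀ (i : Fin m), ∀ k ∈ C, ‖φ i k‖ ≤ B := by
  have hbd : ∀ i : Fin m, ∃ B : ℝ, ∀ k ∈ C, ‖φ i k‖ ≤ B := fun i => hC.exists_bound_of_continuousOn (hφ i).continuousOn
  choose B hB using hbd
  refine ⟨max 1 (∑ j, |B j|), le_max_left _ _, fun i k hk => (hB i k hk).trans ?_⟩
  exact ((le_abs_self _).trans (Finset.single_le_sum (f := fun j => |B j|) (fun j _ => abs_nonneg _) (Finset.mem_univ i))).trans (le_max_right _ _)

/-- **the modulus of the local Siegel character for a unitary `χ`**: `‖χ_v(det_Δ p)·|det_Δ p|_v^{s+n∕2}‖ = |det_Δ p|_v^{re s + n∕2}` when `|det_Δ p|_v > 0`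
(★ `norm_chiDet_eq_one`). [cite: HarrisKudlaSweet1996, §1 (1.15)] -/
theorem norm_localSiegelCharacter_eq {χ : HeckeCharacter L} (hχu : χ.IsUnitary) (s : ℂ) {v : HeightOneSpectrum (𝓞 (Fp L))}
    {p : UnitaryGroup.localPi L (IsCMField.complexConj L) (n + n) (hermD L e dV hdV dW hdW) v}
    (hp : 0 < absDetDelta (Fp L) L (IsCMField.complexConj L) v n p) :
    ‖localSiegelCharacter (Fp L) L (IsCMField.complexConj L) v n (fun w => χ.localComponent w.1) s p‖ =
      absDetDelta (Fp L) L (IsCMField.complexConj L) v n p ^ (s.re + (n : ℝ) / 2) := by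
  have hχv : ∀ (w : UnitaryGroup.PlacesOver L v) (x : (w.1.adicCompletion L)ˣ), ‖(((fun w' : UnitaryGroup.PlacesOver L v => χ.localComponent w'.1) w x : ℂˣ) : ℂ)‖ = 1 :=
    fun w x => by beta_reduce; rw [HeckeCharacter.localComponent_apply, hχu]
  rw [localSiegelCharacter, norm_mul, norm_chiDet_eq_one (Fp L) L (IsCMField.complexConj L) v n _ hχv p, one_mul, Complex.norm_cpow_eq_rpow_re_of_pos hp]
  simp only [Complex.add_re, Complex.div_ofNat_re, Complex.natCast_re]

/-! ## §3 The bound at ONE bad place, uniform in `y ∈ N_Δ(L⁺_v)` -/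

include hdV0 hdW0 in
set_option maxHeartbeats 800000 in -- MEASURED: 400 000 ✗ (`whnf` at the declaration: the ★ p863720-class statement with four `evalPlace ∘ finPart` terms + `hIw` ∕ `rw [hg]`); 800 000 ✓
/-- **THE BOUND AT ONE BAD PLACE `v`, UNIFORM IN `y`.**  For `χ` unitary, `𝒦` standard, flat twists `φ_{i,s} := H_v^{2(s−s₀)}·b_{i,v} ∈ I_v(s, χ_v)` for every `s`, and `re z > 0`
there is `A ≥ 0` with `‖φ_{i,s}((w_Δ)_v·y·h_v)‖ ≤ ∏_{w∣v} A·H_w(h)^{n⌈3 re z∕2 + n∕2⌉}` for all `i`, all `s` with `dist s z < re z∕2`, all `h ∈ H(𝔸)`, all `y ∈ N_Δ(L⁺_v)` (local Iwasawa with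
`K₀` compact, the section law at `s`, `|χ_v| = 1`, Finding 1 ★ `norm_det_blkA_matW_le`, the constants of §2 — see the module docstring).
[cite: KudlaRallis1994, §2] [cite: Kudla1994, §3] [cite: HarrisKudlaSweet1996, §1 (1.11), (1.15)] [cite: BorelJacquet1979, §1.2, §4.1] [cite: Casselman1980, §3] -/
theorem exists_const_of_bad [NeZero n] {χ : HeckeCharacter L} (hχu : χ.IsUnitary) {𝒦 : IwasawaDatum L e dV hdV dW hdW} (h𝒦 : 𝒦.IsStd) (s₀ : ℂ) {m : ℕ}
    (b : Fin m → (v : HeightOneSpectrum (𝓞 (Fp L))) → (UnitaryGroup.localPi L (IsCMField.complexConj L) (n + n) (hermD L e dV hdV dW hdW) v → ℂ)) (v : HeightOneSpectrum (𝓞 (Fp L)))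
    (hbv : ∀ (i : Fin m) (s : ℂ), (fun u => ((modDelta L e dV hdV dW hdW (𝒦.pPart (locToAdelic L e dV hdV dW hdW v u)) : ℝ) : ℂ) ^ (2 * (s - s₀)) * b i v u) ∈
      localDegPS (Fp L) L (IsCMField.complexConj L) (complexConj_imagUnit L) (imagUnit_ne_zero L) (imagUnit_mul_self L)
        v n (gramR_isSymm L e dV hdV dW hdW) (hermD_eq_map_gramD L e dV hdV dW hdW) (fun w => χ.localComponent w.1) s)
    {z : ℂ} (hz : 0 < z.re) :
    ∃ A : ℝ, 0 ≤ A ∧ ∀ (i : Fin m) (s : ℂ), dist s z < z.re / 2 → ∀ (h : HA L e dV hdV dW hdW)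
      (y : UnitaryGroup.localPi L (IsCMField.complexConj L) (n + n) (hermD L e dV hdV dW hdW) v), y ∈ unipDeltaLoc L e dV hdV dW hdW v →
      ‖((modDelta L e dV hdV dW hdW (𝒦.pPart (locToAdelic L e dV hdV dW hdW v (UnitaryGroup.evalPlace (Fp L) L (IsCMField.complexConj L) (n + n) (hermD L e dV hdV dW hdW) v
              (UnitaryGroup.finPart (Fp L) L (IsCMField.complexConj L) (n + n) (hermD L e dV hdV dW hdW) (weylDelta L e dV hdV dW hdW)) * y *
            UnitaryGroup.evalPlace (Fp L) L (IsCMField.complexConj L) (n + n) (hermD L e dV hdV dW hdW) v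
              (UnitaryGroup.finPart (Fp L) L (IsCMField.complexConj L) (n + n) (hermD L e dV hdV dW hdW) h)))) : ℝ) : ℂ) ^ (2 * (s - s₀)) *
        b i v (UnitaryGroup.evalPlace (Fp L) L (IsCMField.complexConj L) (n + n) (hermD L e dV hdV dW hdW) v
              (UnitaryGroup.finPart (Fp L) L (IsCMField.complexConj L) (n + n) (hermD L e dV hdV dW hdW) (weylDelta L e dV hdV dW hdW)) * y *
            UnitaryGroup.evalPlace (Fp L) L (IsCMField.complexConj L) (n + n) (hermD L e dV hdV dW hdW) v
              (UnitaryGroup.finPart (Fp L) L (IsCMField.complexConj L) (n + n) (hermD L e dV hdV dW hdW) h))‖ ≤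
        ∏ w : UnitaryGroup.PlacesOver L v, A * (GLn.localHeight (n + n) L w.1 (h : GL (Fin (n + n)) (AdeleRing (𝓞 L) L)) : ℝ) ^ (n * ⌈3 * z.re / 2 + (n : ℝ) / 2⌉₊) := by
  haveI : Algebra.IsQuadraticExtension (Fp L) L := IsCMField.isQuadraticExtension L
  haveI : NeZero (n + n) := ⟨by have := NeZero.ne n; omega⟩
  -- local Iwasawa decomposition at `v` with a COMPACT `K₀` (★ `exists_isStd_placeAdapted`); the constants `M_v, B_v, R_v, D` on `K₀`; one `c ≥ 1` dominating them
  obtain ⟨-, K₀, -, -, -, -, hK₀c, -, hIw, -, -⟩ := exists_isStd_placeAdapted h𝒦 v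
  obtain ⟨Mv, hMv1, hMv⟩ := exists_height_const L e dV hdV hdV0 dW hdW hdW0 𝒦 hK₀c
  obtain ⟨Bv, hBv1, hBv⟩ := exists_norm_const L e dV hdV dW hdW
    (fun i u => ((modDelta L e dV hdV dW hdW (𝒦.pPart (locToAdelic L e dV hdV dW hdW v u)) : ℝ) : ℂ) ^ (2 * (s₀ - s₀)) * b i v u)
    (fun i => continuous_of_isSmooth (Fp L) L (IsCMField.complexConj L) v n (hbv i s₀).2) hK₀c
  obtain ⟨Rv, hRv1, hRv⟩ := exists_bound_entries_inv_of_isCompact (Fp L) L (IsCMField.complexConj L) (n + n) (hermD L e dV hdV dW hdW) v hK₀c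
  obtain ⟨D, hD⟩ : ∃ D : ℝ, D = 1 + ∑ w : UnitaryGroup.PlacesOver L v, ‖(2 : w.1.adicCompletion L)‖⁻¹ := ⟨_, rfl⟩
  have h2 : ∀ w : UnitaryGroup.PlacesOver L v, 1 ≤ ‖(2 : w.1.adicCompletion L)‖⁻¹ := fun w => one_le_inv_norm_two L w.1
  have hDw : ∀ w : UnitaryGroup.PlacesOver L v, ‖(2 : w.1.adicCompletion L)‖⁻¹ ≤ D := fun w => by
    rw [hD]
    linarith [Finset.single_le_sum (f := fun w' : UnitaryGroup.PlacesOver L v => ‖(2 : w'.1.adicCompletion L)‖⁻¹) (fun w' _ => (zero_le_one.trans (h2 w'))) (Finset.mem_univ w)]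
  obtain ⟨c, hc⟩ : ∃ c : ℝ, c = Mv + Bv + Rv * D := ⟨_, rfl⟩
  have hRv0 : 0 ≤ Rv := zero_le_one.trans hRv1
  have hD1 : 1 ≤ D := by
    rw [hD]; linarith [Finset.sum_nonneg fun (w' : UnitaryGroup.PlacesOver L v) (_ : w' ∈ Finset.univ) => zero_le_one.trans (h2 w')]
  have hc1 : 1 ≤ c := by rw [hc]; nlinarith
  have hMc : Mv ≤ c := by rw [hc]; nlinarith
  have hBc : Bv ≤ c := by rw [hc]; nlinarith
  have hDRc : ∀ w : UnitaryGroup.PlacesOver L v, ‖(2 : w.1.adicCompletion L)‖⁻¹ * Rv ≤ c := fun w => by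
    rw [hc]; nlinarith [hDw w, zero_le_one.trans hMv1, zero_le_one.trans hBv1]
  have hc0 : 0 ≤ c := zero_le_one.trans hc1
  refine ⟨c ^ (⌈3 * z.re + 2 * |s₀.re|⌉₊ + 1) * c ^ (n * ⌈3 * z.re / 2 + (n : ℝ) / 2⌉₊), by positivity, fun i s hs h y hy => ?_⟩
  -- on the ball: `re z∕2 < re s < 3 re z∕2`; decompose `(w_Δ)_v · y · h_v = p · k`; the section law at `s`; then (a) the value at `k`, (b) `|det_Δ p|_v` by Finding 1, (c) assemble
  have hsre : z.re / 2 < s.re ∧ s.re < 3 * z.re / 2 := by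
    have h1 : |s.re - z.re| ≤ dist s z := by rw [Complex.dist_eq, ← Complex.sub_re]; exact Complex.abs_re_le_norm _
    have h3 := abs_lt.1 (lt_of_le_of_lt h1 hs)
    constructor <;> linarith [h3.1, h3.2]
  have hH1 : ∀ w : UnitaryGroup.PlacesOver L v, (1 : ℝ) ≤ (GLn.localHeight (n + n) L w.1 (h : GL (Fin (n + n)) (AdeleRing (𝓞 L) L)) : ℝ) := fun w => by
    exact_mod_cast GLn.one_le_localHeight (n := n + n) (K := L) w.1 (h : GL (Fin (n + n)) (AdeleRing (𝓞 L) L))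
  obtain ⟨p, hp, k, hk, hg⟩ := hIw (UnitaryGroup.evalPlace (Fp L) L (IsCMField.complexConj L) (n + n) (hermD L e dV hdV dW hdW) v
      (UnitaryGroup.finPart (Fp L) L (IsCMField.complexConj L) (n + n) (hermD L e dV hdV dW hdW) (weylDelta L e dV hdV dW hdW)) * y *
    UnitaryGroup.evalPlace (Fp L) L (IsCMField.complexConj L) (n + n) (hermD L e dV hdV dW hdW) v (UnitaryGroup.finPart (Fp L) L (IsCMField.complexConj L) (n + n) (hermD L e dV hdV dW hdW) h))
  have hp' := (mem_siegelDeltaLoc_iff_local L e dV hdV dW hdW v p).1 hp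
  have hlaw := (hbv i s).1 p hp' k
  beta_reduce at hlaw
  rw [hg, hlaw, norm_mul, norm_localSiegelCharacter_eq L e dV hdV dW hdW hχu s
    (absDetDelta_pos (Fp L) L (IsCMField.complexConj L) (complexConj_imagUnit L) (imagUnit_ne_zero L) (imagUnit_mul_self L) v n
      (gramR_isSymm L e dV hdV dW hdW) (hermD_eq_map_gramD L e dV hdV dW hdW) hp')]
  have hHpos : 0 < modDelta L e dV hdV dW hdW (𝒦.pPart (locToAdelic L e dV hdV dW hdW v k)) := iwasawaHeight_pos L e dV hdV dW hdW 𝒦 _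
  have hT : |2 * (s.re - s₀.re)| ≤ ((⌈3 * z.re + 2 * |s₀.re|⌉₊ : ℕ) : ℝ) := by
    refine le_trans ?_ (Nat.le_ceil _)
    rw [abs_mul, abs_two]
    linarith [hsre.2, abs_sub (s.re) (s₀.re), abs_of_pos (lt_trans (half_pos hz) hsre.1)]
  have hφk : ‖((modDelta L e dV hdV dW hdW (𝒦.pPart (locToAdelic L e dV hdV dW hdW v k)) : ℝ) : ℂ) ^ (2 * (s - s₀)) * b i v k‖ ≤
      c ^ (⌈3 * z.re + 2 * |s₀.re|⌉₊ + 1) := by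
    rw [norm_mul, Complex.norm_cpow_eq_rpow_re_of_pos hHpos, pow_succ]
    have e1 : (2 * (s - s₀)).re = 2 * (s.re - s₀.re) := by
      simp only [Complex.mul_re, Complex.sub_re, Complex.sub_im, Complex.re_ofNat, Complex.im_ofNat, zero_mul, sub_zero]
    rw [e1]
    refine mul_le_mul ?_ ?_ (norm_nonneg _) (pow_nonneg hc0 _)
    · calc modDelta L e dV hdV dW hdW (𝒦.pPart (locToAdelic L e dV hdV dW hdW v k)) ^ (2 * (s.re - s₀.re))
            ≤ Mv ^ |2 * (s.re - s₀.re)| := rpow_le_rpow_abs hHpos (hMv k hk).1 (hMv k hk).2 _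
        _ ≤ c ^ |2 * (s.re - s₀.re)| := Real.rpow_le_rpow (zero_le_one.trans hMv1) hMc (abs_nonneg _)
        _ ≤ c ^ (((⌈3 * z.re + 2 * |s₀.re|⌉₊ : ℕ) : ℝ)) := Real.rpow_le_rpow_of_exponent_le hc1 hT
        _ = c ^ ⌈3 * z.re + 2 * |s₀.re|⌉₊ := Real.rpow_natCast c _
    · have hb' := hBv i k hk
      simp only [sub_self, mul_zero, Complex.cpow_zero, one_mul] at hb'
      exact hb'.trans hBc
  have hdet : absDetDelta (Fp L) L (IsCMField.complexConj L) v n p ≤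
      ∏ w : UnitaryGroup.PlacesOver L v, (c * (GLn.localHeight (n + n) L w.1 (h : GL (Fin (n + n)) (AdeleRing (𝓞 L) L)) : ℝ)) ^ n := by
    unfold absDetDelta
    refine Finset.prod_le_prod (fun w _ => norm_nonneg _) fun w _ => ?_
    rw [detDelta_eq_det_blkA (Fp L) L (IsCMField.complexConj L) (complexConj_imagUnit L) (imagUnit_ne_zero L) (imagUnit_mul_self L) v n
      (gramR_isSymm L e dV hdV dW hdW) (hermD_eq_map_gramD L e dV hdV dW hdW) hp' w]
    refine (norm_det_blkA_matW_le L e dV hdV dW hdW v hy hg w (zero_le_one.trans (hH1 w)) hRv0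
      (fun a b => norm_apply_evalPlace_le_localHeight L e dV hdV dW hdW h w a b) (fun a b => hRv k hk w a b)).trans ?_
    refine pow_le_pow_left₀ (mul_nonneg (inv_nonneg.2 (norm_nonneg _)) (mul_nonneg (zero_le_one.trans (hH1 w)) hRv0)) ?_ n
    calc ‖(2 : w.1.adicCompletion L)‖⁻¹ * ((GLn.localHeight (n + n) L w.1 (h : GL (Fin (n + n)) (AdeleRing (𝓞 L) L)) : ℝ) * Rv)
          = (‖(2 : w.1.adicCompletion L)‖⁻¹ * Rv) * (GLn.localHeight (n + n) L w.1 (h : GL (Fin (n + n)) (AdeleRing (𝓞 L) L)) : ℝ) := by ring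
      _ ≤ c * (GLn.localHeight (n + n) L w.1 (h : GL (Fin (n + n)) (AdeleRing (𝓞 L) L)) : ℝ) :=
          mul_le_mul_of_nonneg_right (hDRc w) (zero_le_one.trans (hH1 w))
  have hP1 : 1 ≤ ∏ w : UnitaryGroup.PlacesOver L v, (c * (GLn.localHeight (n + n) L w.1 (h : GL (Fin (n + n)) (AdeleRing (𝓞 L) L)) : ℝ)) ^ n :=
    Finset.one_le_prod fun w _ => one_le_pow₀ (one_le_mul_of_one_le_of_one_le hc1 (hH1 w))
  have hes0 : 0 ≤ s.re + (n : ℝ) / 2 := by have : (0 : ℝ) ≤ n := Nat.cast_nonneg n; linarith [hsre.1]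
  have hesE : s.re + (n : ℝ) / 2 ≤ ((⌈3 * z.re / 2 + (n : ℝ) / 2⌉₊ : ℕ) : ℝ) := le_trans (by linarith [hsre.2]) (Nat.le_ceil _)
  calc absDetDelta (Fp L) L (IsCMField.complexConj L) v n p ^ (s.re + (n : ℝ) / 2) *
        ‖((modDelta L e dV hdV dW hdW (𝒦.pPart (locToAdelic L e dV hdV dW hdW v k)) : ℝ) : ℂ) ^ (2 * (s - s₀)) * b i v k‖
      ≤ (∏ w : UnitaryGroup.PlacesOver L v, (c * (GLn.localHeight (n + n) L w.1 (h : GL (Fin (n + n)) (AdeleRing (𝓞 L) L)) : ℝ)) ^ n) ^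
            (((⌈3 * z.re / 2 + (n : ℝ) / 2⌉₊ : ℕ) : ℝ)) * c ^ (⌈3 * z.re + 2 * |s₀.re|⌉₊ + 1) := by
        refine mul_le_mul ?_ hφk (norm_nonneg _) (Real.rpow_nonneg (zero_le_one.trans hP1) _)
        exact (Real.rpow_le_rpow (absDetDelta_nonneg (Fp L) L (IsCMField.complexConj L) v n p) hdet hes0).trans
          (Real.rpow_le_rpow_of_exponent_le hP1 hesE)
    _ = c ^ (⌈3 * z.re + 2 * |s₀.re|⌉₊ + 1) *
          ∏ w : UnitaryGroup.PlacesOver L v, c ^ (n * ⌈3 * z.re / 2 + (n : ℝ) / 2⌉₊) *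
            (GLn.localHeight (n + n) L w.1 (h : GL (Fin (n + n)) (AdeleRing (𝓞 L) L)) : ℝ) ^ (n * ⌈3 * z.re / 2 + (n : ℝ) / 2⌉₊) := by
        rw [Real.rpow_natCast, mul_comm, ← Finset.prod_pow]
        refine congrArg _ (Finset.prod_congr rfl fun w _ => ?_)
        rw [← pow_mul, mul_pow]
    _ ≤ ∏ w : UnitaryGroup.PlacesOver L v, c ^ (⌈3 * z.re + 2 * |s₀.re|⌉₊ + 1) * c ^ (n * ⌈3 * z.re / 2 + (n : ℝ) / 2⌉₊) *
          (GLn.localHeight (n + n) L w.1 (h : GL (Fin (n + n)) (AdeleRing (𝓞 L) L)) : ℝ) ^ (n * ⌈3 * z.re / 2 + (n : ℝ) / 2⌉₊) := by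
        refine (mul_prod_le_prod_mul (one_le_pow₀ hc1) fun w => ?_).trans (le_of_eq (Finset.prod_congr rfl fun w _ => (mul_assoc _ _ _).symm))
        exact mul_nonneg (pow_nonneg hc0 _) (pow_nonneg (zero_le_one.trans (hH1 w)) _)

/-! ## §4 HEAD: the `hbad` letter of ★ `K2LiuKindWFiniteSectionSupBound.hsup_of_height_of_bad` for a STANDARD datum -/

include hdV0 hdW0 in
/-- **HEAD `hbad_of_std` — THE `S₀`-FACE OF THE SUP LETTER (B) OF ★ p863720, FOR A STANDARD IWASAWA DATUM.**  INPUT: `χ` unitary, `𝒦` standard, the (KW-fac) letter `hb`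
(★ p863597 :178–180) and the reading `hread` of `FvT` (★ p863597 :206–211 at this `T₀`).  OUTPUT: `∃ Tb, ‹hbad›` — K2E3-p03 (g10)'s FROZEN letter (01:36:31Z) of
★ `K2LiuKindWFiniteSectionSupBound.hsup_of_height_of_bad`: on `S₀`, `‖FvT j S h v s ((w_Δ)_v·y·h_v)‖ ≤ ∏_{w∣v} N𝔭_w^{β w}·H_w(h)^{k₁}` for `dist s z < r`, UNIFORMLY in `y`,
`β` supported on `Tb :=` the places over `S₀` (§3 at each `v ∈ S₀`, `r := re z∕2`, `k₁ := n⌈3 re z∕2 + n∕2⌉`, `A_v(z) ≤ N𝔭_w^{⌈A_v(z)⌉}` by ★ `le_absNorm_pow_natCeil`).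
[cite: KudlaRallis1994, §2] [cite: Kudla1994, §3] [cite: HarrisKudlaSweet1996, §1 (1.15)] [cite: BorelJacquet1979, §1.2, §4.1] [cite: Casselman1980, §3] -/
theorem hbad_of_std [NeZero n] (T₀ : Finset (HeightOneSpectrum (𝓞 (Fp L)))) {S₀ : Finset (HeightOneSpectrum (𝓞 (Fp L)))} {χ : HeckeCharacter L} (hχu : χ.IsUnitary)
    {𝒦 : IwasawaDatum L e dV hdV dW hdW} (h𝒦 : 𝒦.IsStd) (s₀ : ℂ) {m : ℕ} (b : Fin m → (v : HeightOneSpectrum (𝓞 (Fp L))) → (UnitaryGroup.localPi L (IsCMField.complexConj L) (n + n) (hermD L e dV hdV dW hdW) v → ℂ))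
    (hb : ∀ i, ∀ v ∈ S₀, ∀ s : ℂ, (fun u => ((modDelta L e dV hdV dW hdW (𝒦.pPart (locToAdelic L e dV hdV dW hdW v u)) : ℝ) : ℂ) ^ (2 * (s - s₀)) * b i v u) ∈
      localDegPS (Fp L) L (IsCMField.complexConj L) (complexConj_imagUnit L) (imagUnit_ne_zero L) (imagUnit_mul_self L)
        v n (gramR_isSymm L e dV hdV dW hdW) (hermD_eq_map_gramD L e dV hdV dW hdW) (fun w => χ.localComponent w.1) s)
    (FvT : Fin m → ∀ (S : skewMatrices ((IsCMField.complexConj L : L ≃ₐ[Fp L] L) : L →+* L) ((gramR L e dV hdV dW hdW).map (algebraMap (Fp L) L)))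
      (h : HA L e dV hdV dW hdW) (v : (kindWFinset L e dV hdV dW hdW T₀ (S : Matrix (Fin n) (Fin n) L) h)),
      ℂ → UnitaryGroup.localPi L (IsCMField.complexConj L) (n + n) (hermD L e dV hdV dW hdW) v.1 → ℂ)
    (hread : ∀ (j : Fin m) (S : skewMatrices ((IsCMField.complexConj L : L ≃ₐ[Fp L] L) : L →+* L) ((gramR L e dV hdV dW hdW).map (algebraMap (Fp L) L)))
      (h : HA L e dV hdV dW hdW) (v : (kindWFinset L e dV hdV dW hdW T₀ (S : Matrix (Fin n) (Fin n) L) h)) (s : ℂ)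
      (y : UnitaryGroup.localPi L (IsCMField.complexConj L) (n + n) (hermD L e dV hdV dW hdW) v.1),
      FvT j S h v s y = if v.1 ∈ S₀ then ((modDelta L e dV hdV dW hdW (𝒦.pPart (locToAdelic L e dV hdV dW hdW v.1 y)) : ℝ) : ℂ) ^ (2 * (s - s₀)) * b j v.1 y
        else LambdaLoc L e dV hdV dW hdW v.1 χ s y) :
    ∃ Tb : Finset (HeightOneSpectrum (𝓞 L)),
    ∀ z : ℂ, 0 < z.re → ∃ (r : ℝ) (k₁ : ℕ) (β : HeightOneSpectrum (𝓞 L) → ℕ), 0 < r ∧ (∀ w ∉ Tb, β w = 0) ∧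
      ∀ (j : Fin m) (S : skewMatrices ((IsCMField.complexConj L : L ≃ₐ[Fp L] L) : L →+* L) ((gramR L e dV hdV dW hdW).map (algebraMap (Fp L) L))) (s : ℂ),
      dist s z < r → ∀ (h : HA L e dV hdV dW hdW) (v : (kindWFinset L e dV hdV dW hdW T₀ (S : Matrix (Fin n) (Fin n) L) h)), v.1 ∈ S₀ →
      ∀ (y : ↥(unipDeltaLoc L e dV hdV dW hdW v.1)),
        ‖FvT j S h v s (UnitaryGroup.evalPlace (Fp L) L (IsCMField.complexConj L) (n + n) (hermD L e dV hdV dW hdW) v.1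
              (UnitaryGroup.finPart (Fp L) L (IsCMField.complexConj L) (n + n) (hermD L e dV hdV dW hdW) (weylDelta L e dV hdV dW hdW)) *
            ((y : ↥(unipDeltaLoc L e dV hdV dW hdW v.1)) : UnitaryGroup.localPi L (IsCMField.complexConj L) (n + n) (hermD L e dV hdV dW hdW) v.1) *
            UnitaryGroup.evalPlace (Fp L) L (IsCMField.complexConj L) (n + n) (hermD L e dV hdV dW hdW) v.1
              (UnitaryGroup.finPart (Fp L) L (IsCMField.complexConj L) (n + n) (hermD L e dV hdV dW hdW) h))‖ ≤
          ∏ w : UnitaryGroup.PlacesOver L v.1, ((Ideal.absNorm w.1.asIdeal : ℕ) : ℝ) ^ β w.1 * (GLn.localHeight (n + n) L w.1 (h : GL (Fin (n + n)) (AdeleRing (𝓞 L) L)) : ℝ) ^ k₁ := by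
  refine ⟨S₀.biUnion fun v => (Finset.univ : Finset (UnitaryGroup.PlacesOver L v)).image fun w => w.1, fun z hz => ?_⟩
  have hP := fun (v : HeightOneSpectrum (𝓞 (Fp L))) (hv : v ∈ S₀) => exists_const_of_bad L e dV hdV hdV0 dW hdW hdW0 hχu h𝒦 s₀ b v (fun i s => hb i v hv s) hz
  choose A hA0 hA using hP
  obtain ⟨β, hβdef⟩ : ∃ β : HeightOneSpectrum (𝓞 L) → ℕ, β = fun w => if hw : w.under (𝓞 (Fp L)) ∈ S₀ then ⌈A (w.under (𝓞 (Fp L))) hw⌉₊ else 0 := ⟨_, rfl⟩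
  have hβ : ∀ (v : HeightOneSpectrum (𝓞 (Fp L))) (hv : v ∈ S₀) (w : UnitaryGroup.PlacesOver L v), β w.1 = ⌈A v hv⌉₊ := by
    rintro v hv ⟨w, rfl⟩; simp only [hβdef, dif_pos hv]
  refine ⟨z.re / 2, n * ⌈3 * z.re / 2 + (n : ℝ) / 2⌉₊, β, half_pos hz, fun w hw => ?_, fun j S s hs h v hv y => ?_⟩
  · by_cases hw' : w.under (𝓞 (Fp L)) ∈ S₀
    · refine absurd (Finset.mem_biUnion.2 ⟨w.under (𝓞 (Fp L)), hw', ?_⟩) hw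
      exact Finset.mem_image_of_mem (fun w' : UnitaryGroup.PlacesOver L (w.under (𝓞 (Fp L))) => w'.1) (Finset.mem_univ (⟨w, rfl⟩ : UnitaryGroup.PlacesOver L (w.under (𝓞 (Fp L)))))
    · simp only [hβdef, dif_neg hw']
  · rw [hread, if_pos hv]
    refine (hA v.1 hv j s hs h _ y.2).trans (Finset.prod_le_prod (fun w _ => ?_) fun w _ => ?_)
    · exact mul_nonneg (hA0 v.1 hv) (pow_nonneg NNReal.zero_le_coe _)
    · rw [hβ v.1 hv w]
      exact mul_le_mul_of_nonneg_right (le_absNorm_pow_natCeil L w.1 _) (pow_nonneg NNReal.zero_le_coe _)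

set_option maxHeartbeats 400000 in
include hdV0 hdW0 in
/-- **§5 `hsup_of_height` — THE SUP LETTER (B) OF ★ p863720 `hsizeLoc_of_place`, CLOSED FOR A STANDARD IWASAWA DATUM** (one `obtain` for the tie):
★ `K2LiuKindWFiniteSectionSupBound.hsup_of_height_of_bad` (K2E3-p03 (g10): off `S₀` the unramified `Λ_{s,v}`, Findings 1–2; `b₁ := 0`, `Tβ := Tb ∪ {w ∣ 2}`) ∘ §4 `hbad_of_std`
(on `S₀`): `∃ b₁ Tβ, ‹★ p863720 :243–:254›`. [cite: KudlaRallis1994, §2] [cite: Kudla1994, §3] [cite: HarrisKudlaSweet1996, §1 (1.15)] [cite: Casselman1980, §3] [cite: BorelJacquet1979, §4.1] -/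
theorem hsup_of_height [NeZero n] (T₀ : Finset (HeightOneSpectrum (𝓞 (Fp L)))) {S₀ : Finset (HeightOneSpectrum (𝓞 (Fp L)))} {χ : HeckeCharacter L} (hχu : χ.IsUnitary)
    (hχS₀ : ∀ v, v ∉ S₀ → ∀ w : UnitaryGroup.PlacesOver L v, χ.IsUnramifiedAt w.1) {𝒦 : IwasawaDatum L e dV hdV dW hdW} (h𝒦 : 𝒦.IsStd) (s₀ : ℂ) {m : ℕ}
    (b : Fin m → (v : HeightOneSpectrum (𝓞 (Fp L))) → (UnitaryGroup.localPi L (IsCMField.complexConj L) (n + n) (hermD L e dV hdV dW hdW) v → ℂ))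
    (hb : ∀ i, ∀ v ∈ S₀, ∀ s : ℂ, (fun u => ((modDelta L e dV hdV dW hdW (𝒦.pPart (locToAdelic L e dV hdV dW hdW v u)) : ℝ) : ℂ) ^ (2 * (s - s₀)) * b i v u) ∈
      localDegPS (Fp L) L (IsCMField.complexConj L) (complexConj_imagUnit L) (imagUnit_ne_zero L) (imagUnit_mul_self L)
        v n (gramR_isSymm L e dV hdV dW hdW) (hermD_eq_map_gramD L e dV hdV dW hdW) (fun w => χ.localComponent w.1) s)
    (FvT : Fin m → ∀ (S : skewMatrices ((IsCMField.complexConj L : L ≃ₐ[Fp L] L) : L →+* L) ((gramR L e dV hdV dW hdW).map (algebraMap (Fp L) L)))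
      (h : HA L e dV hdV dW hdW) (v : (kindWFinset L e dV hdV dW hdW T₀ (S : Matrix (Fin n) (Fin n) L) h)),
      ℂ → UnitaryGroup.localPi L (IsCMField.complexConj L) (n + n) (hermD L e dV hdV dW hdW) v.1 → ℂ)
    (hread : ∀ (j : Fin m) (S : skewMatrices ((IsCMField.complexConj L : L ≃ₐ[Fp L] L) : L →+* L) ((gramR L e dV hdV dW hdW).map (algebraMap (Fp L) L)))
      (h : HA L e dV hdV dW hdW) (v : (kindWFinset L e dV hdV dW hdW T₀ (S : Matrix (Fin n) (Fin n) L) h)) (s : ℂ)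
      (y : UnitaryGroup.localPi L (IsCMField.complexConj L) (n + n) (hermD L e dV hdV dW hdW) v.1),
      FvT j S h v s y = if v.1 ∈ S₀ then ((modDelta L e dV hdV dW hdW (𝒦.pPart (locToAdelic L e dV hdV dW hdW v.1 y)) : ℝ) : ℂ) ^ (2 * (s - s₀)) * b j v.1 y
        else LambdaLoc L e dV hdV dW hdW v.1 χ s y)
    (π : ∀ v : HeightOneSpectrum (𝓞 (Fp L)), v.adicCompletion (Fp L)) :
    ∃ (b₁ : ℕ) (Tβ : Finset (HeightOneSpectrum (𝓞 L))),
    ∀ z : ℂ, 0 < z.re → ∃ (r : ℝ) (k₁ : ℕ) (β : HeightOneSpectrum (𝓞 L) → ℕ), 0 < r ∧ (∀ w ∉ Tβ, β w = 0) ∧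
      ∀ (j : Fin m) (S : skewMatrices ((IsCMField.complexConj L : L ≃ₐ[Fp L] L) : L →+* L) ((gramR L e dV hdV dW hdW).map (algebraMap (Fp L) L))) (s : ℂ),
      dist s z < r → ∀ (h : HA L e dV hdV dW hdW) (v : (kindWFinset L e dV hdV dW hdW T₀ (S : Matrix (Fin n) (Fin n) L) h)) (a : ℕ)
        (y : ↥(unipDeltaLoc L e dV hdV dW hdW v.1)), y ∈ kindWLocalBall L e dV hdV dW hdW v.1 (π v.1) (-(a : ℤ)) →
        ‖FvT j S h v s (UnitaryGroup.evalPlace (Fp L) L (IsCMField.complexConj L) (n + n) (hermD L e dV hdV dW hdW) v.1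
              (UnitaryGroup.finPart (Fp L) L (IsCMField.complexConj L) (n + n) (hermD L e dV hdV dW hdW) (weylDelta L e dV hdV dW hdW)) *
            ((y : ↥(unipDeltaLoc L e dV hdV dW hdW v.1)) : UnitaryGroup.localPi L (IsCMField.complexConj L) (n + n) (hermD L e dV hdV dW hdW) v.1) *
            UnitaryGroup.evalPlace (Fp L) L (IsCMField.complexConj L) (n + n) (hermD L e dV hdV dW hdW) v.1
              (UnitaryGroup.finPart (Fp L) L (IsCMField.complexConj L) (n + n) (hermD L e dV hdV dW hdW) h))‖ ≤
          (∏ w : UnitaryGroup.PlacesOver L v.1, ((Ideal.absNorm w.1.asIdeal : ℕ) : ℝ) ^ β w.1 * (GLn.localHeight (n + n) L w.1 (h : GL (Fin (n + n)) (AdeleRing (𝓞 L) L)) : ℝ) ^ k₁) *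
            ((Ideal.absNorm v.1.asIdeal : ℕ) : ℝ) ^ (b₁ * a) := by
  obtain ⟨Tb, hbad⟩ := hbad_of_std L e dV hdV hdV0 dW hdW hdW0 T₀ hχu h𝒦 s₀ b hb FvT hread
  exact hsup_of_height_of_bad L e dV hdV dW hdW T₀ hχu hχS₀ 𝒦 s₀ b FvT hread π Tb hbad
end CM

end Summit.HodgeConjecture.HodgeConjecture.Cruxes.HLiu418.K2LiuKindWFiniteSectionSupBoundBad

end
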